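import Summits.QuantumFields.BalabanUV.Beta.FP.RemainderLedgerGen
import Summits.QuantumFields.BalabanUV.Beta.FP.FineSplitJunctionFar

/-!
# `BalabanUV.Beta.FP.FineSplitJunctionGen` — road «FP» for binder row D1, ROW KER-γ, RULING R-FP-40 row «E-COLS» (TAKEN CLAIMS 2026-08-21 l.28847, statement
# l.28858), sequel of `FP/RemainderLedgerGen`: the FAR ENTRY and the FINE-SPLIT END of the (α0) junction with the END COLUMNS ABSTRACT — `rem_far_gen`
# (`FineSplitJunctionFar.rem_far_perfCol` with the sharp column letter DISPLAYED) and `hasym_PiBF_of_fineSplit_gen` (`FineSplitJunction.hasym_PiBF_of_fineSplit`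
# ∕ its `_of_cov` twin with the columns `colOf (KPerf…m)` ↦ `colOf (Kp m)` of an abstract packed family carrying (L0)(L1)(LE))

HONEST DEPENDENCY (page 1, mandatory): continuum YM on T⁴ ⇐ BetaPertH ∧ nine spine estimates (0/9 proved); BetaPertH ⇐ (D1) ∧ (D4) ∧
CAP+tail; G-an2-4 gates asym, D1 and NE2/3/4.  HONEST FRAMING (cell contract, verbatim): «discharging `BetaPertH` makes Bałaban's UV
stability UNCONDITIONAL — a real constructive-QFT result; it is NOT the continuum limit and NOT the Clay problem.»  THIS MODULE is [our object]∕[folklore]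
COMPOSITION BY NAME over `FineSplitJunctionFar.rem_far_twoPoint`, `FineSplitJunction.hsplit_of_fineSplit` (both already generic in a packed `K`) and
`RemainderLedgerGen.hasym_PiBF_of_pieces_gen`; no `def`, no `def … : Prop`, nothing cited, nothing of the manuscripts under audit asserted, 0 sorry; no existing file
touched.  NOT COL-SYM, NOT hsplit, NOT (ASYMP) for the literal, NOT D1; 0∕4 row-D1 binders; NOT BetaPertH, NOT continuum, NOT Clay.

ABSOLUTE RULE (cell charter, verbatim): «No internally-minted statement may enter as a cited fact. Every hypothesis is either kernel-proved in this
package or a verbatim quotation of a PUBLISHED theorem with page reference. The manuscript(s) under audit are NOT citable for their own disputed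
steps — they are the thing under adjudication; programme-internal (2001/route/tribunal) claims are never citable.»

CONTENT: §1 [folklore] **`rem_far_gen`**; §2 [our object] **`hasym_PiBF_of_fineSplit_gen`**.
Provenance: D1 formalisation swarm LEAF PROVER 01, unit `b2b-balaban-beta-d1-formalise-leaf-01` gen 12, 2026-08-21, road FP row E-COLS (R-FP-40).
-/

noncomputable section

namespace Summit.QuantumFields.BalabanUV.Beta.FP.FineSplitJunctionGen

open Finset
open scoped BigOperators
open Literature.MathematicalPhysics.QuantumFieldTheory.Balaban1983to89
open Literature.MathematicalPhysics.QuantumFieldTheory.Balaban1983to89.Beta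
open Literature.MathematicalPhysics.QuantumFieldTheory.Balaban1983to89.Beta.BubbleTransfer (c4)
open Literature.MathematicalPhysics.QuantumFieldTheory.Balaban1983to89.B12Normalization (stepBal)
open B12Sec2to5 (l1 l1_nonneg)
open PolarizationSign (AxisReflectionCovariant reflSign)
open ExpKernelCalculus (Site MKer Decays BiLoc comp shiftK tr tadpole bubble Zl Zl_nonneg)
open OneStepResolventKernel (Fib LocStencil)
open OneStepKernelFamily (flipK colH)
open KernelWard (divV divW)
open KernelReflection (LegMap refK bondRefl)
open DyadicShell (Pt supNorm)
open DecimatedMomentSummable (ConstReproSum LinReproSum AbsMoment₂)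
open DressedMomentNormalisation (EKer dressedEntry)
open LeadingCoefficient (kappaBal)
open Summit.QuantumFields.BalabanUV.Beta.GAN24.CombesThomas (sfStep smStep)
open Summit.QuantumFields.BalabanUV.Beta.D1BFx.MomentTransferPeriodicSum (dressedSumP)
open Summit.QuantumFields.BalabanUV.Beta.D1BFx.MomentTransferPeriodicEntry (EKer₂ dressedEntryP)
open Summit.QuantumFields.BalabanUV.Beta.FP.PerfectObjectsT (KPerf)
open Summit.QuantumFields.BalabanUV.Beta.FP.TransportInfinityM (colOf)
open Summit.QuantumFields.BalabanUV.Beta.FP.HorizontalBookkeeping (truncK truncK_apply)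
open Summit.QuantumFields.BalabanUV.Beta.FP.WilsonCubicGerm (cubicGermOf)
open Summit.QuantumFields.BalabanUV.Beta.FP.GhostCubicGerm (cubicGermOfSc)
open Summit.QuantumFields.BalabanUV.Beta.FP.BubbleGermValue (bfGerm ghostGerm)
open Summit.QuantumFields.BalabanUV.Beta.FP.PerfectPolarization (Pker G0ker PiBF)
open Summit.QuantumFields.BalabanUV.Beta.FP.PerfectPolarizationDecay (sextic_PiBF)
open Summit.QuantumFields.BalabanUV.Beta.FP.FineSplitJunction (hsplit_of_fineSplit)
open Summit.QuantumFields.BalabanUV.Beta.FP.FineSplitJunctionFar (rem_far_twoPoint exp_rate_mono)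
open Summit.QuantumFields.BalabanUV.Beta.FP.RemainderLedgerGen (hasym_PiBF_of_pieces_gen)

variable {Lc : ℕ} [NeZero Lc]

/-! ## §1 The far entry of the ledger with the sharp column letter displayed -/

omit [NeZero Lc] in
/-- **THE FAR ENTRY OF THE LEDGER, SHARP COLUMN LETTER DISPLAYED** [folklore] (`FineSplitJunctionFar.rem_far_perfCol` with `abs_colOf_KPerf_le_sharp` REPLACED by
the letter (LS) `|colOf (Kp m) κ l x| ≤ Cs∕(Lc^m)⁵·e^{−(κs∕Lc^m)|x|₁}`): for pieces supported off the window with the far letter `C‖s′−s‖⁻⁶·e^{−(a∕N)‖s′−s‖}·N⁸`,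
one m-FREE `B` bounds their ledger line — `rem_far_twoPoint` BY NAME at the common rate `min (κs) (2a)`. -/
theorem rem_far_gen (hLc : 2 ≤ Lc) {Kp : ℕ → MKer (3 + 1) (Fib 3)} {Cs κs : ℝ} (hCs : 0 ≤ Cs) (hκs : 0 < κs)
    (hws : ∀ m : ℕ, 1 ≤ m → ∀ (κ l : Fin 4) (x : Pt),
      |colOf (Kp m) κ l x| ≤ Cs / ((Lc ^ m : ℕ) : ℝ) ^ 5 * Real.exp (-(κs / ((Lc ^ m : ℕ) : ℝ)) * l1 x))
    {G : ℕ → EKer₂ 4} {C a : ℝ} (hC : 0 ≤ C) (ha : 0 < a)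
    (hGfar : ∀ m : ℕ, 1 ≤ m → ∀ (c' e : Fin 4) (s s' : Pt), Lc ^ m < supNorm (s' - s) →
      |G m c' e s s'| ≤ ((Lc ^ m : ℕ) : ℝ) ^ 8 *
        (C / (supNorm (s' - s) : ℝ) ^ 6 * Real.exp (-(a / ((Lc ^ m : ℕ) : ℝ)) * (supNorm (s' - s) : ℝ))))
    (hGnear : ∀ m : ℕ, 1 ≤ m → ∀ (c' e : Fin 4) (s s' : Pt), supNorm (s' - s) ≤ Lc ^ m → G m c' e s s' = 0) (μ ν : Fin 4) :
    ∃ B : ℝ, 0 ≤ B ∧ ∀ m : ℕ, 1 ≤ m → ∀ S : Finset Pt,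
      ∑ u ∈ S, (supNorm u : ℝ) ^ 2 *
        |dressedEntryP (fun c' a' => colH (Kp m) (Lc ^ m) a' 0 c') (G m) (((Lc ^ m : ℕ) : ℤ) • (-u)) μ ν| ≤ B := by
  set δ : ℝ := min κs (2 * a) with hδdef
  have hδ : 0 < δ := lt_min hκs (by positivity)
  have hδκ : δ ≤ κs := min_le_left _ _
  have hδa : δ / 2 ≤ a := by have := min_le_right κs (2 * a); rw [← hδdef] at this; linarith
  refine ⟨16 * C * Cs ^ 2 * (Real.exp (δ / 4) * (1 + 8 / δ) ^ 4) ^ 2 * (2 * Real.exp (δ / 16) * (16 / δ) ^ 2 * (1 + 32 / δ) ^ 4),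
    by positivity, fun m hm S => ?_⟩
  have hN1 : 1 ≤ Lc ^ m := Nat.one_le_pow _ _ (by omega)
  have hN0 : (0 : ℝ) < ((Lc ^ m : ℕ) : ℝ) := by exact_mod_cast (show 0 < Lc ^ m by omega)
  -- the column letter at the common rate
  have hw : ∀ (κ l : Fin 4) (x : Pt), |colOf (Kp m) κ l x|
      ≤ Cs / ((Lc ^ m : ℕ) : ℝ) ^ 5 * Real.exp (-(δ / ((Lc ^ m : ℕ) : ℝ)) * l1 x) := by
    intro κ l x
    refine (hws m hm κ l x).trans (mul_le_mul_of_nonneg_left ?_ (by positivity))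
    exact exp_rate_mono hδκ (l1_nonneg x) hN0
  -- the far letter at half the common rate
  have hGfar' : ∀ (c' e : Fin 4) (s s' : Pt), Lc ^ m < supNorm (s' - s) →
      |G m c' e s s'| ≤ ((Lc ^ m : ℕ) : ℝ) ^ 8 *
        (C / (supNorm (s' - s) : ℝ) ^ 6 * Real.exp (-(δ / (2 * ((Lc ^ m : ℕ) : ℝ))) * (supNorm (s' - s) : ℝ))) := by
    intro c' e s s' hfar
    refine (hGfar m hm c' e s s' hfar).trans (mul_le_mul_of_nonneg_left (mul_le_mul_of_nonneg_left ?_ (by positivity)) (by positivity))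
    have h2 : δ / (2 * ((Lc ^ m : ℕ) : ℝ)) = (δ / 2) / ((Lc ^ m : ℕ) : ℝ) := by rw [div_div]
    rw [h2]
    exact exp_rate_mono hδa (Nat.cast_nonneg _) hN0
  exact rem_far_twoPoint (K := Kp m) (N := Lc ^ m) (G := G m) hN1 hδ hCs hC hGfar' (hGnear m hm) hw μ ν S

/-! ## §2 The fine-split END with the END columns abstract -/

/-- **(ASYMP) MODULO A FINE SPLIT, THE PIECE LEDGER, THE REFLECTION LETTER AND THE COLUMN LETTERS** [our object]: `PerfectAsymptoticsBFCov.hasym_PiBF_of_fineSplit_of_cov`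
with the END columns `colOf (KPerf…m)` ∕ sandwich columns `colH (KPerf…m) (Lc^m)` REPLACED by those of an abstract packed family `Kp m` carrying (L0)(L1)(LE)
(absolute summability of the columns follows from (LE)). -/
theorem hasym_PiBF_of_fineSplit_gen (hLc : 2 ≤ Lc) (wg wgh : ℝ)
    {V : Fin 4 → Site 4 → MKer 4 (Fib 3)} {W : Fin 4 → Site 4 → Fin 4 → Site 4 → MKer 4 (Fib 3)}
    {v : Fin 4 → Site 4 → MKer 4 Unit} {w : Fin 4 → Site 4 → Fin 4 → Site 4 → MKer 4 Unit} {Cv Cw Cx Cw' Cx' CwL CwL' cQ δ : ℝ} (hδ : 0 < δ)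
    -- admissible-family letters, gluon sector
    (hV : ∀ (μ : Fin 4) (y : Site 4), BiLoc (V μ y) y y Cv δ) (hW : ∀ (μ : Fin 4) (y : Site 4) (ν : Fin 4) (y' : Site 4), BiLoc (W μ y ν y') y y' Cw δ)
    (hcovV : ∀ (μ : Fin 4) (y t : Site 4), V μ (y + t) = shiftK (-t) (V μ y))
    (hcovW : ∀ (μ : Fin 4) (y : Site 4) (ν : Fin 4) (y' t : Site 4), W μ (y + t) ν (y' + t) = shiftK (-t) (W μ y ν y'))
    (X : Site 4 → MKer 4 (Fib 3)) (hX : ∀ y, BiLoc (X y) y y Cx δ)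
    (hW1 : ∀ y, comp (comp Pker (divV V y)) Pker = comp Pker (X y) - comp (X y) Pker)
    (hW2 : ∀ y ν y', divW W y ν y' = comp (X y) (V ν y') - comp (V ν y') (X y))
    (hKcov : AxisReflectionCovariant (flipK (PiBF wg wgh V W v w)))
    (h0V : ∀ (lam α β : Fin 4), ∑' p : Pt × Pt, V lam 0 p.1 p.2 (Sum.inl α) (Sum.inl β) = 0)
    (hgermV : cubicGermOf V = cQ • bfGerm)
    (hWloc : ∀ (μ ν : Fin 4) (z : Pt), BiLoc (W μ 0 ν z) 0 z (CwL * Real.exp (-δ * l1 z)) δ)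
    -- admissible-family letters, ghost sector
    (hv : ∀ (μ : Fin 4) (y : Site 4), BiLoc (v μ y) y y Cv δ) (hw : ∀ (μ : Fin 4) (y : Site 4) (ν : Fin 4) (y' : Site 4), BiLoc (w μ y ν y') y y' Cw' δ)
    (hcovv : ∀ (μ : Fin 4) (y t : Site 4), v μ (y + t) = shiftK (-t) (v μ y))
    (hcovw : ∀ (μ : Fin 4) (y : Site 4) (ν : Fin 4) (y' t : Site 4), w μ (y + t) ν (y' + t) = shiftK (-t) (w μ y ν y'))
    (Xg : Site 4 → MKer 4 Unit) (hXg : ∀ y, BiLoc (Xg y) y y Cx' δ)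
    (hW1g : ∀ y, comp (comp G0ker (divV v y)) G0ker = comp G0ker (Xg y) - comp (Xg y) G0ker)
    (hW2g : ∀ y ν y', divW w y ν y' = comp (Xg y) (v ν y') - comp (v ν y') (Xg y))
    (h0v : ∀ lam : Fin 4, ∑' p : Pt × Pt, v lam 0 p.1 p.2 () () = 0)
    (hgermv : cubicGermOfSc v = ghostGerm)
    (hwloc : ∀ (μ ν : Fin 4) (z : Pt), BiLoc (w μ 0 ν z) 0 z (CwL' * Real.exp (-δ * l1 z)) δ)
    -- the colour weights and the entry
    {N : ℝ} (hn : (40 * wg * (1 / 4 : ℝ) * (c4 * cQ) ^ 2 - wgh * (-(1 / 2 : ℝ)) * c4 ^ 2) / 3 = kappaBal N)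
    {μ ν : Fin 4} (hμν : μ ≠ ν)
    -- THE ABSTRACT COLUMN FAMILY: a packed `Kp m` with the m-UNIFORM END transport letters (L0)(L1)(LE) of `colOf (Kp m)`
    {Kp : ℕ → MKer (3 + 1) (Fib 3)} {δc cc : ℝ} (hδc : 0 < δc) (hcc : 0 ≤ cc)
    (hw0 : ∀ m : ℕ, 1 ≤ m → ∀ κ l, ConstReproSum (Lc ^ m) (colOf (Kp m) κ l)
      (if κ = l then ((((Lc ^ m : ℕ) : ℝ) ^ (4 + 1))⁻¹) else 0))
    (hw1 : ∀ m : ℕ, 1 ≤ m → ∃ Cw : Fin 4 → Fin 4 → Fin 4 → ℝ, ∀ κ l, LinReproSum (Lc ^ m) (colOf (Kp m) κ l) (Cw κ l))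
    (hwE : ∀ m : ℕ, 1 ≤ m → ∀ κ l, Summable fun x : Pt => Real.exp (δc / ((Lc ^ m : ℕ) : ℝ) * l1 x) * |colOf (Kp m) κ l x|)
    (hwEb : ∀ m : ℕ, 1 ≤ m → ∀ κ l,
      ∑' x : Pt, Real.exp (δc / ((Lc ^ m : ℕ) : ℝ) * l1 x) * |colOf (Kp m) κ l x| ≤ cc / ((Lc ^ m : ℕ) : ℝ))
    -- the sandwich form of the coarse tables, the FINE split against the transported `PiBF`, bounded pieces, and the piece ledger
    {T : ℕ → Fin 4 → Fin 4 → Pt → ℝ} {F : ℕ → EKer₂ 4} {ι : Type*} (I : Finset ι) {G : ι → ℕ → EKer₂ 4} {B : ι → ℝ}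
    (hsand : ∀ m : ℕ, 1 ≤ m → ∀ u : Pt,
      T m μ ν u = dressedEntryP (fun c a => colH (Kp m) (Lc ^ m) a 0 c) (F m)
        (((Lc ^ m : ℕ) : ℤ) • (-u)) μ ν)
    (hfine : ∀ m : ℕ, 1 ≤ m → ∀ (c e : Fin 4) (s s' : Pt),
      F m c e s s' - ((Lc ^ m : ℕ) : ℝ) ^ 8 * truncK (PiBF wg wgh V W v w) (Lc ^ m) c e (s' - s) = ∑ i ∈ I, G i m c e s s')
    (hGb : ∀ i ∈ I, ∀ m : ℕ, 1 ≤ m → ∀ c e : Fin 4, ∃ A, ∀ s s', |G i m c e s s'| ≤ A)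
    (hpieces : ∀ i ∈ I, ∀ m : ℕ, 1 ≤ m → ∀ S : Finset Pt, ∑ u ∈ S, (supNorm u : ℝ) ^ 2 *
      |dressedEntryP (fun c a => colH (Kp m) (Lc ^ m) a 0 c) (G i m)
        (((Lc ^ m : ℕ) : ℤ) • (-u)) μ ν| ≤ B i) :
    ∃ U₀ : ℝ, 0 ≤ U₀ ∧ ∃ Cg : ℝ, ∀ m : ℕ, 1 ≤ m →
      |B12Beta.secondMoment (T m) μ ν - (m : ℝ) * stepBal N Lc| ≤ (U₀ + ∑ i ∈ I, B i) + Cg := by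
  -- (K6) gives a bound of `PiBF`, hence of its truncations
  have hLoc : LocStencil V Cv δ := fun κ u => hV κ u
  have hcovV0 : ∀ (lam : Fin 4) (u : Site 4), V lam u = shiftK (-u) (V lam 0) := fun lam u => by
    have h := hcovV lam 0 u; rwa [zero_add] at h
  have hcovv0 : ∀ (lam : Fin 4) (u : Site 4), v lam u = shiftK (-u) (v lam 0) := fun lam u => by
    have h := hcovv lam 0 u; rwa [zero_add] at h
  obtain ⟨C, hC0, hK⟩ := sextic_PiBF (wg := wg) (wgh := wgh) (cQ := cQ) hδ hLoc hcovV0 h0V hgermV hWloc hv hcovv0 h0v hgermv hwloc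
  have hKf : ∀ c e : Fin 4, ∃ A, ∀ t, |PiBF wg wgh V W v w c e t| ≤ A := fun c e =>
    ⟨C, fun t => (hK c e t).trans (div_le_self hC0 (one_le_pow₀ (by
      have : (0 : ℝ) ≤ (supNorm t : ℝ) := Nat.cast_nonneg _
      linarith)))⟩
  -- the column letter (absolute summability of the END columns) from (LE)
  have hcol : ∀ m, 1 ≤ m → ∀ κ l : Fin 4, Summable fun u => |colOf (Kp m) κ l u| := fun m hm κ l =>
    (hwE m hm κ l).of_nonneg_of_le (fun _ => abs_nonneg _) fun x =>
      le_mul_of_one_le_left (abs_nonneg _) (Real.one_le_exp (mul_nonneg (by positivity) (l1_nonneg x)))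
  -- the END's `hsplit`, from the fine split
  have hsplit := hsplit_of_fineSplit I (K := Kp) (Nb := fun m => Lc ^ m)
    (T := T) (F := F) (G := G) (μ := μ) (ν := ν) hKf hcol hsand hfine hGb
  exact hasym_PiBF_of_pieces_gen hLc wg wgh hδ hV hW hcovV hcovW X hX hW1 hW2 hKcov h0V hgermV hWloc hv hw hcovv hcovw Xg hXg hW1g hW2g
    h0v hgermv hwloc hn hμν hδc hcc hw0 hw1 hwE hwEb I hsplit hpieces

end Summit.QuantumFields.BalabanUV.Beta.FP.FineSplitJunctionGen

end
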